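import Mathlib
import Summits.Parity.BatemanHorn.Theorems.IsogenyRedeiPolyMobiusTailStubSignedTypeIOfKernel

/-!
# Crux `PolyMobiusTail` (stmt-Parity-0870), line `Sketch`: the strip for `k ≥ 2` — auxiliary lemmas

Lead prover `prover-line-stmt-Parity-0870-c1-0`. General lemmas (no stub content) used by the assembly of
the registered stub `stub_strip_two_le` (the natural tail of a Bateman–Horn system between the cut-offs
`x^{1-η}` and `x/(log x)^{2k+2}` sums to `o(x)`) in `…StripTwoLe.lean`:

* pointwise algebra: complementary cut-offs (`sum_ite_lt_eq_sub`) and the binomial `T`-expansion of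
  `∏ᵢ μ(dᵢ) log(mᵢ/dᵢ)` (`truncated_natural_expand`);
* real-variable facts about the two cut-offs (`eventually_cutoff_facts`) and the two error models
  `(log x)^a (1 + log y)^b · y (log y)^c = o(x)` at `y = x/(log x)^m` (`a + b + c + 1 ≤ m`) and at `y = x^θ`
  (`θ < 1`);
* abstract asymptotic bookkeeping: approximation error (`approx_isLittleO`), main term at the upper
  cut-off (`main_upper_isLittleO`), `(x + 1 − N₀) · o(1) = o(x)`, and passing from full sums to tail sums.

Everything here is proved. [folklore]
-/

open scoped BigOperators Topology
open Filter Finset Polynomial Asymptotics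

namespace Summit.Parity.BatemanHorn.Theorems.PolyMobiusTail.NaturalForm.StripTwoLe

/-! ### Pointwise algebra: complementary cut-offs and the `T`-expansion -/

/-- Complementary cut-offs: `Σ_d [y < P d] w d = Σ_d w d − Σ_d [P d ≤ y] w d`. [folklore] -/
theorem sum_ite_lt_eq_sub {α : Type*} (D : Finset α) (P : α → ℝ) (w : α → ℝ) (y : ℝ) :
    (∑ d ∈ D, if y < P d then w d else 0) = (∑ d ∈ D, w d) - ∑ d ∈ D, if P d ≤ y then w d else 0 := by
  rw [eq_sub_iff_add_eq, ← Finset.sum_add_distrib]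
  refine Finset.sum_congr rfl fun d _ => ?_
  by_cases h : y < P d
  · rw [if_pos h, if_neg (not_le.mpr h), add_zero]
  · rw [if_neg h, if_pos (not_lt.mp h), zero_add]

/-- Binomial expansion `∏ᵢ μᵢ (Lᵢ - ℓᵢ) = Σ_T (-1)^{|univ \ T|} (∏_{i∈T} Lᵢ) · (∏ᵢ μᵢ) ∏_{i∉T} ℓᵢ`. [folklore] -/
theorem prod_mul_sub_expand {k : ℕ} (μ L ℓ : Fin k → ℝ) :
    ∏ i, (μ i * (L i - ℓ i)) = ∑ T ∈ (Finset.univ : Finset (Fin k)).powerset,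
      (-1 : ℝ) ^ (Finset.univ \ T).card * (∏ i ∈ T, L i) *
        ((∏ i, μ i) * ∏ i ∈ Finset.univ \ T, ℓ i) := by
  have h : ∀ i, μ i * (L i - ℓ i) = μ i * L i + -(μ i * ℓ i) := fun i => by ring
  simp_rw [h]
  rw [Finset.prod_add]
  refine Finset.sum_congr rfl fun T _ => ?_
  rw [Finset.prod_neg, Finset.prod_mul_distrib, Finset.prod_mul_distrib,
    ← Finset.prod_mul_prod_compl T μ, Finset.compl_eq_univ_sdiff]
  ring

/-- The `T`-expansion of the truncated natural sum at an argument where all values are `≥ 1`: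
`Σ_{d ∣ m, ∏dᵢ ≤ y} ∏ᵢ μ(dᵢ) log(mᵢ/dᵢ) = Σ_T (-1)^{|univ∖T|} (∏_{i∈T} log mᵢ) · P_T(m, y)`. [folklore] -/
theorem truncated_natural_expand {k : ℕ} (m : Fin k → ℕ) (y : ℝ) :
    (∑ d ∈ Fintype.piFinset (fun i => (m i).divisors),
        if ∏ i, (d i : ℝ) ≤ y then
          ∏ i, ((ArithmeticFunction.moebius (d i) : ℝ) * Real.log ((m i : ℝ) / (d i : ℝ))) else 0)
      = ∑ T ∈ (Finset.univ : Finset (Fin k)).powerset,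
          (-1 : ℝ) ^ (Finset.univ \ T).card * ((∏ i ∈ T, Real.log (m i : ℝ)) *
            ∑ d ∈ Fintype.piFinset (fun i => (m i).divisors),
              if ∏ i, (d i : ℝ) ≤ y then
                (∏ i, (ArithmeticFunction.moebius (d i) : ℝ)) * ∏ i ∈ Finset.univ \ T, Real.log (d i)
              else 0) := by
  have hmem : ∀ d ∈ Fintype.piFinset (fun i => (m i).divisors), ∀ i,
      ((m i : ℕ) : ℝ) ≠ 0 ∧ ((d i : ℕ) : ℝ) ≠ 0 := by
    intro d hd i
    have hi := Fintype.mem_piFinset.mp hd i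
    exact ⟨Nat.cast_ne_zero.mpr (Nat.mem_divisors.mp hi).2,
      Nat.cast_ne_zero.mpr (Nat.pos_of_mem_divisors hi).ne'⟩
  -- expand each summand, then swap the sums
  have hexp : ∀ d ∈ Fintype.piFinset (fun i => (m i).divisors),
      (if ∏ i, (d i : ℝ) ≤ y then
          ∏ i, ((ArithmeticFunction.moebius (d i) : ℝ) * Real.log ((m i : ℝ) / (d i : ℝ))) else 0)
        = ∑ T ∈ (Finset.univ : Finset (Fin k)).powerset,
          (-1 : ℝ) ^ (Finset.univ \ T).card * ((∏ i ∈ T, Real.log (m i : ℝ)) *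
            (if ∏ i, (d i : ℝ) ≤ y then
              (∏ i, (ArithmeticFunction.moebius (d i) : ℝ)) * ∏ i ∈ Finset.univ \ T, Real.log (d i)
             else 0)) := by
    intro d hd
    split_ifs with hP
    · have he : ∏ i, ((ArithmeticFunction.moebius (d i) : ℝ) * Real.log ((m i : ℝ) / (d i : ℝ)))
          = ∏ i, ((ArithmeticFunction.moebius (d i) : ℝ) *
              (Real.log (m i : ℝ) - Real.log ((d i : ℕ) : ℝ))) :=
        Finset.prod_congr rfl fun i _ => by rw [Real.log_div (hmem d hd i).1 (hmem d hd i).2]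
      rw [he, prod_mul_sub_expand]
      refine Finset.sum_congr rfl fun T _ => ?_
      ring
    · simp
  rw [Finset.sum_congr rfl hexp, Finset.sum_comm]
  refine Finset.sum_congr rfl fun T _ => ?_
  rw [← Finset.mul_sum, ← Finset.mul_sum]


/-! ### Real-variable facts about the two cut-offs `y₁ = x^{1-η}` and `y₂ = x/(log x)^m` -/

/-- Eventually (in `x : ℕ`): `1 ≤ log x`, and for `y₂ = x/(log x)^m`: `2 ≤ y₂ ≤ x` and
`log x ≤ 2 log y₂`. [folklore] -/
theorem eventually_cutoff_facts (m : ℕ) :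
    ∀ᶠ x : ℕ in atTop, 1 ≤ Real.log x ∧ 2 ≤ (x : ℝ) / Real.log x ^ m ∧
      (x : ℝ) / Real.log x ^ m ≤ x ∧ Real.log x ≤ 2 * Real.log ((x : ℝ) / Real.log x ^ m) := by
  -- `(log x)^m ≤ x^{1/2}` eventually, as real `x → ∞`
  have h1 : ∀ᶠ t : ℝ in atTop, Real.log t ^ m ≤ t ^ (1 / 2 : ℝ) := by
    have h := isLittleO_log_rpow_rpow_atTop (m : ℝ) (by norm_num : (0 : ℝ) < 1 / 2)
    have h' := h.bound (by norm_num : (0 : ℝ) < 1)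
    filter_upwards [h', eventually_ge_atTop (1 : ℝ)] with t ht ht1
    rw [one_mul, Real.norm_eq_abs, Real.norm_eq_abs, Real.rpow_natCast,
      abs_of_nonneg (pow_nonneg (Real.log_nonneg ht1) _),
      abs_of_nonneg (Real.rpow_nonneg (by linarith) _)] at ht
    exact ht
  have h2 : ∀ᶠ t : ℝ in atTop, (4 : ℝ) ≤ t ^ (1 / 2 : ℝ) :=
    (tendsto_rpow_atTop (by norm_num : (0 : ℝ) < 1 / 2)).eventually_ge_atTop 4
  have h3 : ∀ᶠ t : ℝ in atTop, Real.exp 1 ≤ t := eventually_ge_atTop _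
  have hall := (h1.and (h2.and h3))
  filter_upwards [tendsto_natCast_atTop_atTop.eventually hall] with x hx
  obtain ⟨hlog, h4, he⟩ := hx
  have hx0 : (0 : ℝ) < x := lt_of_lt_of_le (Real.exp_pos 1) he
  have hlog1 : 1 ≤ Real.log x := by
    rw [Real.le_log_iff_exp_le hx0]; exact he
  have hL0 : 0 < Real.log (x : ℝ) ^ m := pow_pos (by linarith) m
  have hL1 : 1 ≤ Real.log (x : ℝ) ^ m := one_le_pow₀ hlog1
  have hsqrt : (x : ℝ) ^ (1 / 2 : ℝ) * (x : ℝ) ^ (1 / 2 : ℝ) = x := by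
    rw [← Real.rpow_add hx0]; norm_num
  have hsqrt0 : 0 < (x : ℝ) ^ (1 / 2 : ℝ) := Real.rpow_pos_of_pos hx0 _
  -- `y₂ ≥ x^{1/2} ≥ 4`
  have hy_ge : (x : ℝ) ^ (1 / 2 : ℝ) ≤ (x : ℝ) / Real.log x ^ m := by
    rw [le_div_iff₀ hL0]
    calc (x : ℝ) ^ (1 / 2 : ℝ) * Real.log x ^ m ≤ (x : ℝ) ^ (1 / 2 : ℝ) * (x : ℝ) ^ (1 / 2 : ℝ) :=
          mul_le_mul_of_nonneg_left hlog hsqrt0.le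
      _ = x := hsqrt
  refine ⟨hlog1, by linarith, div_le_self hx0.le hL1, ?_⟩
  -- `log x = 2 log x^{1/2} ≤ 2 log y₂`
  have hlogs : Real.log ((x : ℝ) ^ (1 / 2 : ℝ)) = 1 / 2 * Real.log x := Real.log_rpow hx0 _
  have hmono : Real.log ((x : ℝ) ^ (1 / 2 : ℝ)) ≤ Real.log ((x : ℝ) / Real.log x ^ m) :=
    Real.log_le_log hsqrt0 hy_ge
  linarith

/-- The error model at the upper cut-off: `(log x)^a (1 + log y₂)^b · y₂ (log y₂)^c = o(x)` for
`y₂ = x/(log x)^m` whenever `a + b + c + 1 ≤ m`. [folklore] -/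
theorem isLittleO_error_upper (a b c m : ℕ) (habc : a + b + c + 1 ≤ m) :
    (fun x : ℕ => Real.log x ^ a * (1 + Real.log ((x : ℝ) / Real.log x ^ m)) ^ b *
        ((x : ℝ) / Real.log x ^ m * Real.log ((x : ℝ) / Real.log x ^ m) ^ c))
      =o[atTop] fun x : ℕ => (x : ℝ) := by
  -- compare with `2^b · x / log x`
  have hmodel : (fun x : ℕ => (x : ℝ) / Real.log x) =o[atTop] fun x : ℕ => (x : ℝ) := by
    have h := SignedTypeIAux.isLittleO_model 0 1 0 0 (by norm_num : (0 : ℝ) < 1)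
    refine h.congr' (Eventually.of_forall fun x => ?_) EventuallyEq.rfl
    simp
  refine IsBigO.trans_isLittleO ?_ hmodel
  refine IsBigO.of_bound ((2 : ℝ) ^ b) ?_
  filter_upwards [eventually_cutoff_facts m] with x hx
  obtain ⟨hlog1, hy2, hyx, -⟩ := hx
  set y : ℝ := (x : ℝ) / Real.log x ^ m with hy
  have hx0 : (0 : ℝ) < x := by
    have : (0 : ℝ) < Real.log x := by linarith
    exact_mod_cast Nat.pos_of_ne_zero fun h => by simp [h] at this
  have hlog0 : 0 < Real.log x := by linarith
  have hy1 : 1 ≤ y := by linarith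
  have hlogy0 : 0 ≤ Real.log y := Real.log_nonneg hy1
  have hlogyx : Real.log y ≤ Real.log x := Real.log_le_log (by linarith) hyx
  have h1 : (1 + Real.log y) ^ b ≤ (2 * Real.log x) ^ b :=
    pow_le_pow_left₀ (by linarith) (by linarith) b
  have h2 : Real.log y ^ c ≤ Real.log x ^ c := pow_le_pow_left₀ hlogy0 hlogyx c
  rw [Real.norm_eq_abs, Real.norm_eq_abs, abs_of_nonneg (by positivity),
    abs_of_nonneg (by positivity)]
  -- `y = x/(log x)^m` and `(log x)^{a+b+c} ≤ (log x)^{m-1}`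
  have hpow : Real.log x ^ a * (2 * Real.log x) ^ b * Real.log x ^ c =
      (2 : ℝ) ^ b * Real.log x ^ (a + b + c) := by
    rw [mul_pow, pow_add, pow_add]; ring
  have hle : Real.log x ^ (a + b + c) * ((x : ℝ) / Real.log x ^ m) ≤ (x : ℝ) / Real.log x := by
    rw [mul_div_assoc', div_le_div_iff₀ (pow_pos hlog0 m) hlog0]
    have e : Real.log x ^ (a + b + c) * x * Real.log x = x * Real.log x ^ (a + b + c + 1) := by ring
    rw [e]
    exact mul_le_mul_of_nonneg_left (pow_le_pow_right₀ hlog1 habc) hx0.le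
  calc Real.log x ^ a * (1 + Real.log y) ^ b * (y * Real.log y ^ c)
      ≤ Real.log x ^ a * (2 * Real.log x) ^ b * (y * Real.log x ^ c) := by
        gcongr
    _ = (2 : ℝ) ^ b * (Real.log x ^ (a + b + c) * y) := by
        rw [show Real.log x ^ a * (2 * Real.log x) ^ b * (y * Real.log x ^ c) =
          (Real.log x ^ a * (2 * Real.log x) ^ b * Real.log x ^ c) * y by ring, hpow]
        ring
    _ ≤ (2 : ℝ) ^ b * ((x : ℝ) / Real.log x) := by
        rw [hy]
        exact mul_le_mul_of_nonneg_left hle (by positivity)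

/-- The error model at the lower cut-off: `(log x)^a (1 + log x^θ)^b · x^θ (log x^θ)^c = o(x)` for
`0 < θ < 1`. [folklore] -/
theorem isLittleO_error_lower (a b c : ℕ) {θ : ℝ} (hθ0 : 0 < θ) (hθ1 : θ < 1) :
    (fun x : ℕ => Real.log x ^ a * (1 + Real.log ((x : ℝ) ^ θ)) ^ b *
        ((x : ℝ) ^ θ * Real.log ((x : ℝ) ^ θ) ^ c))
      =o[atTop] fun x : ℕ => (x : ℝ) := by
  have hmodel : (fun x : ℕ => Real.log x ^ (a + b + c) * (x : ℝ) ^ θ) =o[atTop] fun x : ℕ => (x : ℝ) := by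
    have h := SignedTypeIAux.isLittleO_model 0 0 1 (a + b + c) hθ1
    refine h.congr' (Eventually.of_forall fun x => ?_) EventuallyEq.rfl
    simp
  refine IsBigO.trans_isLittleO ?_ hmodel
  refine IsBigO.of_bound ((2 : ℝ) ^ b) ?_
  filter_upwards [eventually_cutoff_facts 0] with x hx
  obtain ⟨hlog1, -, -, -⟩ := hx
  have hlog0 : 0 < Real.log x := by linarith
  have hx0 : (0 : ℝ) < x := by
    exact_mod_cast Nat.pos_of_ne_zero fun h => by simp [h] at hlog0
  have hx1 : (1 : ℝ) ≤ x := by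
    by_contra h
    push Not at h
    have := Real.log_nonpos hx0.le h.le
    linarith
  have hlogy : Real.log ((x : ℝ) ^ θ) = θ * Real.log x := Real.log_rpow hx0 θ
  have hlogy0 : 0 ≤ Real.log ((x : ℝ) ^ θ) := by rw [hlogy]; positivity
  have hlogyx : Real.log ((x : ℝ) ^ θ) ≤ Real.log x := by
    rw [hlogy]; nlinarith
  rw [Real.norm_eq_abs, Real.norm_eq_abs, abs_of_nonneg (by positivity),
    abs_of_nonneg (by positivity)]
  have h1 : (1 + Real.log ((x : ℝ) ^ θ)) ^ b ≤ (2 * Real.log x) ^ b :=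
    pow_le_pow_left₀ (by linarith) (by linarith) b
  have h2 : Real.log ((x : ℝ) ^ θ) ^ c ≤ Real.log x ^ c := pow_le_pow_left₀ hlogy0 hlogyx c
  calc Real.log x ^ a * (1 + Real.log ((x : ℝ) ^ θ)) ^ b * ((x : ℝ) ^ θ * Real.log ((x : ℝ) ^ θ) ^ c)
      ≤ Real.log x ^ a * (2 * Real.log x) ^ b * ((x : ℝ) ^ θ * Real.log x ^ c) := by gcongr
    _ = (2 : ℝ) ^ b * (Real.log x ^ (a + b + c) * (x : ℝ) ^ θ) := by
        rw [mul_pow, pow_add, pow_add]; ring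


/-! ### Abstract asymptotic lemmas (no polynomial content) -/

/-- Approximation error: if `|U x y − X x · V y| ≤ C₁ (log x)^a (1 + log y)^b R y` (`x ≥ N₀`, `y ≥ 1`),
`R y ≤ C₂ y (log y)^c` (`y ≥ 2`), `R ≥ 0`, the cut-off `yf x ≥ 2` eventually, and the model
`(log x)^a (1 + log yf)^b yf (log yf)^c = o(x)`, then `U x (yf x) − X x · V (yf x) = o(x)`. [folklore] -/
theorem approx_isLittleO (U : ℕ → ℝ → ℝ) (X : ℕ → ℝ) (V R : ℝ → ℝ) (yf : ℕ → ℝ) {N₀ : ℕ}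
    {C₁ C₂ : ℝ} {a b c : ℕ}
    (hU : ∀ x : ℕ, N₀ ≤ x → ∀ y : ℝ, 1 ≤ y →
      |U x y - X x * V y| ≤ C₁ * Real.log x ^ a * (1 + Real.log y) ^ b * R y)
    (hR : ∀ y : ℝ, 2 ≤ y → R y ≤ C₂ * y * Real.log y ^ c) (hR0 : ∀ y, 0 ≤ R y)
    (hy2 : ∀ᶠ x : ℕ in atTop, 2 ≤ yf x)
    (hmodel : (fun x : ℕ => Real.log x ^ a * (1 + Real.log (yf x)) ^ b * (yf x * Real.log (yf x) ^ c))
      =o[atTop] fun x : ℕ => (x : ℝ)) :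
    (fun x : ℕ => U x (yf x) - X x * V (yf x)) =o[atTop] fun x : ℕ => (x : ℝ) := by
  refine IsBigO.trans_isLittleO ?_ hmodel
  refine IsBigO.of_bound (|C₁| * |C₂|) ?_
  filter_upwards [hy2, eventually_ge_atTop N₀] with x hx2 hxN
  have hx1 : (1 : ℝ) ≤ yf x := by linarith
  have hlogy : 0 ≤ Real.log (yf x) := Real.log_nonneg hx1
  have hlogx : 0 ≤ Real.log (x : ℝ) := Real.log_natCast_nonneg x
  have hm0 : 0 ≤ Real.log x ^ a * (1 + Real.log (yf x)) ^ b * (yf x * Real.log (yf x) ^ c) := by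
    positivity
  rw [Real.norm_eq_abs, Real.norm_eq_abs, abs_of_nonneg hm0]
  calc |U x (yf x) - X x * V (yf x)|
      ≤ C₁ * Real.log x ^ a * (1 + Real.log (yf x)) ^ b * R (yf x) := hU x hxN (yf x) hx1
    _ ≤ |C₁| * Real.log x ^ a * (1 + Real.log (yf x)) ^ b * R (yf x) := by
        gcongr
        · exact hR0 _
        · exact le_abs_self C₁
    _ ≤ |C₁| * Real.log x ^ a * (1 + Real.log (yf x)) ^ b * (|C₂| * yf x * Real.log (yf x) ^ c) := by
        refine mul_le_mul_of_nonneg_left ((hR (yf x) hx2).trans ?_) (by positivity)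
        gcongr
        exact le_abs_self C₂
    _ = |C₁| * |C₂| * (Real.log x ^ a * (1 + Real.log (yf x)) ^ b * (yf x * Real.log (yf x) ^ c)) := by
        ring

/-- Main term for `T ≠ ∅` at the upper cut-off: if `0 ≤ X x ≤ x (K log x)^a` (`x ≥ N₀`, `K ≥ 0`) and
`|V y| ≤ C/(log y)^{a+1}` (`y ≥ 2`), then `X x · V(x/(log x)^m) = o(x)`. [folklore] -/
theorem main_upper_isLittleO (X : ℕ → ℝ) (V : ℝ → ℝ) {N₀ : ℕ} {K C : ℝ} {a : ℕ} (m : ℕ)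
    (hK0 : 0 ≤ K) (hX0 : ∀ x, 0 ≤ X x)
    (hX : ∀ x : ℕ, N₀ ≤ x → X x ≤ (x : ℝ) * (K * Real.log x) ^ a)
    (hV : ∀ y : ℝ, 2 ≤ y → |V y| ≤ C / Real.log y ^ (a + 1)) :
    (fun x : ℕ => X x * V ((x : ℝ) / Real.log x ^ m)) =o[atTop] fun x : ℕ => (x : ℝ) := by
  have hC0 : 0 ≤ C := by
    have h := (abs_nonneg _).trans (hV 2 le_rfl)
    have hl : 0 < Real.log (2 : ℝ) ^ (a + 1) := pow_pos (Real.log_pos (by norm_num)) _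
    by_contra hneg
    have : C / Real.log 2 ^ (a + 1) < 0 := div_neg_of_neg_of_pos (by linarith) hl
    linarith
  have hmodel : (fun x : ℕ => (x : ℝ) / Real.log x) =o[atTop] fun x : ℕ => (x : ℝ) := by
    have h := SignedTypeIAux.isLittleO_model 0 1 0 0 (by norm_num : (0 : ℝ) < 1)
    refine h.congr' (Eventually.of_forall fun x => ?_) EventuallyEq.rfl
    simp
  refine IsBigO.trans_isLittleO ?_ hmodel
  refine IsBigO.of_bound (K ^ a * C * 2 ^ (a + 1)) ?_
  filter_upwards [eventually_cutoff_facts m, eventually_ge_atTop N₀] with x hx hxN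
  obtain ⟨hlog1, hy2, -, hlog2⟩ := hx
  set y : ℝ := (x : ℝ) / Real.log x ^ m with hy
  have hlog0 : 0 < Real.log x := by linarith
  have hx0 : (0 : ℝ) < x := by
    exact_mod_cast Nat.pos_of_ne_zero fun h => by simp [h] at hlog0
  have hlogy : 0 < Real.log y := Real.log_pos (by linarith)
  rw [Real.norm_eq_abs, Real.norm_eq_abs, abs_mul, abs_of_nonneg (hX0 x),
    abs_of_nonneg (show (0 : ℝ) ≤ (x : ℝ) / Real.log x by positivity)]
  -- `1/(log y)^{a+1} ≤ 2^{a+1}/(log x)^{a+1}`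
  have hden : (Real.log x) ^ (a + 1) ≤ (2 : ℝ) ^ (a + 1) * Real.log y ^ (a + 1) := by
    rw [← mul_pow]; exact pow_le_pow_left₀ hlog0.le hlog2 _
  have hV' : |V y| ≤ C * 2 ^ (a + 1) / Real.log x ^ (a + 1) := by
    refine (hV y hy2).trans ?_
    rw [div_le_div_iff₀ (pow_pos hlogy _) (pow_pos hlog0 _)]
    calc C * Real.log x ^ (a + 1) ≤ C * ((2 : ℝ) ^ (a + 1) * Real.log y ^ (a + 1)) :=
          mul_le_mul_of_nonneg_left hden hC0
      _ = C * 2 ^ (a + 1) * Real.log y ^ (a + 1) := by ring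
  calc X x * |V y| ≤ ((x : ℝ) * (K * Real.log x) ^ a) * (C * 2 ^ (a + 1) / Real.log x ^ (a + 1)) :=
        mul_le_mul (hX x hxN) hV' (abs_nonneg _) (by positivity)
    _ = K ^ a * C * 2 ^ (a + 1) * ((x : ℝ) / Real.log x) := by
        rw [mul_pow, pow_succ]
        field_simp
        ring

/-- If `g x → 0` then `(x + 1 − N₀) · g x = o(x)`. [folklore] -/
theorem card_mul_tendsto_zero_isLittleO (g : ℕ → ℝ) (N₀ : ℕ) (hg : Tendsto g atTop (𝓝 0)) :
    (fun x : ℕ => ((x + 1 - N₀ : ℕ) : ℝ) * g x) =o[atTop] fun x : ℕ => (x : ℝ) := by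
  have hO : (fun x : ℕ => ((x + 1 - N₀ : ℕ) : ℝ)) =O[atTop] (fun x : ℕ => (x : ℝ)) := by
    refine IsBigO.of_bound 2 ?_
    filter_upwards [eventually_ge_atTop 1] with x hx
    rw [Real.norm_eq_abs, Real.norm_eq_abs, abs_of_nonneg (Nat.cast_nonneg _),
      abs_of_nonneg (Nat.cast_nonneg _)]
    have : ((x + 1 - N₀ : ℕ) : ℝ) ≤ x + 1 := by exact_mod_cast Nat.sub_le (x + 1) N₀
    have hx1 : (1 : ℝ) ≤ x := by exact_mod_cast hx
    linarith
  have ho : (fun x : ℕ => g x) =o[atTop] (fun _ : ℕ => (1 : ℝ)) := (isLittleO_one_iff ℝ).mpr hg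
  simpa only [mul_one] using hO.mul_isLittleO ho

/-- From the full sum to the tail sum: if `Σ_{1≤n≤x} u n (yf x) = o(x)` and `|u n y| ≤ G n` for all
`n, y`, then `Σ_{N₀≤n≤x} u n (yf x) = o(x)`. [folklore] -/
theorem tail_sum_isLittleO (u : ℕ → ℝ → ℝ) (G : ℕ → ℝ) (yf : ℕ → ℝ) {N₀ : ℕ} (hN₀ : 1 ≤ N₀)
    (huG : ∀ n y, |u n y| ≤ G n)
    (hfull : (fun x : ℕ => ∑ n ∈ Finset.Icc 1 x, u n (yf x)) =o[atTop] fun x : ℕ => (x : ℝ)) :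
    (fun x : ℕ => ∑ n ∈ Finset.Icc N₀ x, u n (yf x)) =o[atTop] fun x : ℕ => (x : ℝ) := by
  -- the initial segment is bounded
  have hinit : (fun x : ℕ => ∑ n ∈ (Finset.Icc 1 x).filter (fun n => n < N₀), u n (yf x))
      =o[atTop] fun x : ℕ => (x : ℝ) := by
    have hB : (fun x : ℕ => ∑ n ∈ (Finset.Icc 1 x).filter (fun n => n < N₀), u n (yf x))
        =O[atTop] fun _ : ℕ => (1 : ℝ) := by
      refine IsBigO.of_bound (∑ n ∈ Finset.range N₀, G n) (Eventually.of_forall fun x => ?_)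
      rw [Real.norm_eq_abs, norm_one, mul_one]
      exact signedTypeI_initial_le u G huG N₀ x (yf x)
    refine hB.trans_isLittleO ?_
    exact isLittleO_const_left.2 (Or.inr (tendsto_norm_atTop_atTop.comp tendsto_natCast_atTop_atTop))
  have hsub := hfull.sub hinit
  refine hsub.congr' ?_ EventuallyEq.rfl
  filter_upwards [eventually_ge_atTop N₀] with x hx
  rw [← Finset.sum_filter_add_sum_filter_not (Finset.Icc 1 x) (fun n => n < N₀), add_sub_cancel_left]
  refine Finset.sum_congr ?_ fun _ _ => rfl
  ext n
  simp only [Finset.mem_filter, Finset.mem_Icc, not_lt]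
  omega

end Summit.Parity.BatemanHorn.Theorems.PolyMobiusTail.NaturalForm.StripTwoLe

namespace Summit.Parity.BatemanHorn.Theorems.PolyMobiusTail.NaturalForm

/-- **Stub `stub_truncated_natural_expand`** (registered auxiliary stub of line `Sketch`, the head of this
file): the `T`-expansion of the truncated natural divisor-tuple sum,
`Σ_{dᵢ ∣ mᵢ, ∏dᵢ ≤ y} ∏ᵢ μ(dᵢ) log(mᵢ/dᵢ) = Σ_T (-1)^{|univ∖T|} (∏_{i∈T} log mᵢ) · Σ_{dᵢ ∣ mᵢ, ∏dᵢ ≤ y} (∏ μ(dᵢ)) ∏_{i∉T} log dᵢ`.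
[folklore] -/
theorem stub_truncated_natural_expand : ∀ (k : ℕ) (m : Fin k → ℕ) (y : ℝ),
    (∑ d ∈ Fintype.piFinset (fun i => (m i).divisors),
        if ∏ i, (d i : ℝ) ≤ y then
          ∏ i, ((ArithmeticFunction.moebius (d i) : ℝ) * Real.log ((m i : ℝ) / (d i : ℝ))) else 0)
      = ∑ T ∈ (Finset.univ : Finset (Fin k)).powerset,
          (-1 : ℝ) ^ (Finset.univ \ T).card * ((∏ i ∈ T, Real.log (m i : ℝ)) *
            ∑ d ∈ Fintype.piFinset (fun i => (m i).divisors),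
              if ∏ i, (d i : ℝ) ≤ y then
                (∏ i, (ArithmeticFunction.moebius (d i) : ℝ)) * ∏ i ∈ Finset.univ \ T, Real.log (d i)
              else 0) :=
  fun _ m y => StripTwoLe.truncated_natural_expand m y

end Summit.Parity.BatemanHorn.Theorems.PolyMobiusTail.NaturalForm
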